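import Mathlib
import Summits.CriticalPhenomena.Ising3DConformalLimit.Theorems.GaussianScaleMixtureCriticalTwoPointGSMJsTrigSum
import Summits.CriticalPhenomena.Ising3DConformalLimit.Theorems.GaussianScaleMixtureCriticalTwoPointGSMJsCesaroIdentity
import Summits.CriticalPhenomena.Ising3DConformalLimit.Theorems.GaussianScaleMixtureCriticalTwoPointGSMJsApproximants
import Summits.CriticalPhenomena.Ising3DConformalLimit.Theorems.GaussianScaleMixtureCriticalTwoPointGSMJsPairCountTendsto
import Summits.CriticalPhenomena.Ising3DConformalLimit.Theorems.GaussianScaleMixtureCriticalTwoPointGSMJsCompactness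
import Summits.CriticalPhenomena.Ising3DConformalLimit.Theorems.GaussianScaleMixtureCriticalTwoPointGSMJsMomentDeterminacy
import Summits.CriticalPhenomena.Ising3DConformalLimit.Theorems.GaussianScaleMixtureCriticalTwoPointGSMJsNoAtom

/-!
# The joint (axial × transverse) spectral measure of the critical two-point function of the 3D
Ising model (route `GaussianScaleMixture`, crux `CriticalTwoPointGSM`, line `Sketch`, canonical-lift
spine — registered stubs `jointSpectralMeasure`, `jointSpectralMeasure_noAtom`)

Write a site of `ℤ³` as `Fin.cons n z` (`n ∈ ℤ` the reflection-positive axis, `z ∈ ℤ²` transverse)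
and a point of the spectral side as `p : Fin 3 → ℝ` with `p 0 = λ` (transfer-matrix eigenvalue) and
`(p 1, p 2) = k` (transverse momentum). We prove:

* `jointSpectralMeasure`: there is a probability measure `ρ` on `ℝ³` carried by the box
  `[0,1] × [-π,π]²` with `⟨σ₀σ_{(n,z)}⟩⁺_{β_c(3)} = ∫ λ^{|n|} cos(k·z) dρ(λ,k)` for every `n ∈ ℤ`,
  `z ∈ ℤ²` — the Källén–Lehmann / transfer-matrix spectral representation JOINTLY in the axial and
  transverse variables (Aizenman–Duminil-Copin 2021, Prop. 5.3 / App. Prop. 8.6, quadratic-form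
  version = `Theorems.mixedSpectralRepresentation_proof`, upgraded by Bochner's theorem in the
  transverse momentum; Glimm–Jaffe 1987 §6.1). The Bochner upgrade is done WITHOUT a Herglotz
  theorem: the finite-`N` probability measures of `js_approximants` (Hausdorff measures of the real
  coefficient vectors `cos(k_j·x)𝟙_{[0,N)²}`, `sin(k_j·x)𝟙_{[0,N)²}` at the `(2N)²` discrete momenta
  `k_j = πj/N`, glued by the character orthogonality `js_trigSum` and the bookkeeping
  `js_cesaroIdentity`) represent the Cesàro-weighted function `#{(x,y) ∈ [0,N)⁴ : x−y = z}·G(n,z)/N²`;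
  the weights tend to one (`js_pairCount_tendsto`) and Prokhorov on the compact support
  (`js_compactness`) gives `ρ`.
* `jointSpectralMeasure_noAtom`: such a `ρ` exists with, moreover, NO MASS at `λ ≤ 0` — automatic for
  every representing `ρ` by `js_noAtom` (the `λ`-marginal is the determinate Hausdorff measure of the
  axis, `js_momentDeterminacy`, which is the image under `a ↦ e^{-a}` of the Laplace-form measure of
  `AizenmanDuminilCopin2021_prop_8_6_holds`: the transfer matrix of the nearest-neighbour Ising model
  is positive definite).

References: M. Aizenman, H. Duminil-Copin, Ann. of Math. 194 (2021) = arXiv:1912.07973, §5.3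
Prop. 5.3 and Appendix §8.3 Prop. 8.6; J. Glimm, A. Jaffe, *Quantum Physics* (1987) §6.1;
C. Berg, J. P. R. Christensen, P. Ressel, *Harmonic Analysis on Semigroups* (1984) Ch. 4 Thm. 2.8.
-/

namespace Summit.CriticalPhenomena.Ising3DConformalLimit.Theorems

open MeasureTheory Filter Topology
open Literature.Probability.LatticeModels
open scoped BigOperators

noncomputable section

/-- **The joint spectral measure of the critical two-point function (registered stub
`jointSpectralMeasure`).** There is a probability measure `ρ` on `ℝ³` carried by
`[0,1] × [-π,π]²` with `⟨σ₀σ_{(n,z)}⟩⁺_{β_c} = ∫ λ^{|n|} cos(k·z) dρ(λ,k)` for every `n ∈ ℤ` and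
`z ∈ ℤ²` (Aizenman–Duminil-Copin 2021 Prop. 5.3 / 8.6 + Bochner in the transverse momentum, via the
discrete-momentum Cesàro construction `js_approximants` / `js_pairCount_tendsto` / `js_compactness`). -/
theorem jointSpectralMeasure :
    ∃ ρ : Measure (Fin 3 → ℝ), IsProbabilityMeasure ρ ∧
      ρ {p | 0 ≤ p 0 ∧ p 0 ≤ 1 ∧ ∀ j : Fin 2, -Real.pi ≤ p j.succ ∧ p j.succ ≤ Real.pi}ᶜ = 0 ∧
      ∀ (n : ℤ) (z : Fin 2 → ℤ), criticalTwoPoint 3 (Fin.cons n z) =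
        ∫ p, (p 0) ^ n.natAbs * Real.cos (∑ j : Fin 2, p j.succ * (z j : ℝ)) ∂ρ := by
  have happ := js_approximants (js_cesaroIdentity js_trigSum)
  -- choose the approximants (junk below `N = 0`, never used in the limit)
  have hex : ∀ N : ℕ, ∃ ρ : Measure (Fin 3 → ℝ), IsProbabilityMeasure ρ ∧
      ρ {p | 0 ≤ p 0 ∧ p 0 ≤ 1 ∧ ∀ j : Fin 2, -Real.pi ≤ p j.succ ∧ p j.succ ≤ Real.pi}ᶜ = 0 ∧
      (1 ≤ N → ∀ (n : ℤ) (z : Fin 2 → ℤ), (∀ i : Fin 2, |z i| < N) →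
        ∫ p, (p 0) ^ n.natAbs * Real.cos (∑ j : Fin 2, p j.succ * (z j : ℝ)) ∂ρ =
          ((((Fintype.piFinset (fun _ : Fin 2 => Finset.Ico (0 : ℤ) N)) ×ˢ
              (Fintype.piFinset (fun _ : Fin 2 => Finset.Ico (0 : ℤ) N))).filter
              (fun xy => xy.1 - xy.2 = z)).card : ℝ) / (N : ℝ) ^ 2 *
            criticalTwoPoint 3 (Fin.cons n z)) := by
    intro N
    rcases Nat.eq_zero_or_pos N with h0 | hpos
    · obtain ⟨ρ, hP, hsupp, -⟩ := happ 1 le_rfl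
      exact ⟨ρ, hP, hsupp, fun h => by omega⟩
    · obtain ⟨ρ, hP, hsupp, hmom⟩ := happ N hpos
      exact ⟨ρ, hP, hsupp, fun _ => hmom⟩
  choose ρs hP hsupp hmom using hex
  -- the joint moments of the approximants converge to `G(n,z)`
  have hlim : ∀ (n : ℤ) (z : Fin 2 → ℤ), Tendsto (fun N =>
      ∫ p, (p 0) ^ n.natAbs * Real.cos (∑ j : Fin 2, p j.succ * (z j : ℝ)) ∂(ρs N)) atTop
      (𝓝 (criticalTwoPoint 3 (Fin.cons n z))) := by
    intro n z
    have hw := (js_pairCount_tendsto z).mul_const (criticalTwoPoint 3 (Fin.cons n z))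
    rw [one_mul] at hw
    refine hw.congr' ?_
    -- eventually (`N > |z|_∞`) the moment IS the weighted value
    obtain ⟨M, hM⟩ : ∃ M : ℕ, ∀ i : Fin 2, (z i).natAbs < M := by
      refine ⟨(Finset.univ.sup fun i => (z i).natAbs) + 1, fun i => ?_⟩
      have : (z i).natAbs ≤ Finset.univ.sup fun i => (z i).natAbs :=
        Finset.le_sup (f := fun i => (z i).natAbs) (Finset.mem_univ i)
      omega
    rw [EventuallyEq, eventually_atTop]
    refine ⟨M + 1, fun N hN => ?_⟩
    have hzN : ∀ i : Fin 2, |z i| < N := fun i => by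
      rw [← Int.natCast_natAbs]
      have := hM i
      exact_mod_cast (by omega : (z i).natAbs < N)
    exact (hmom N (by omega) n z hzN).symm
  obtain ⟨ρ, hPρ, hsuppρ, hmomρ⟩ := js_compactness ρs (fun n z => criticalTwoPoint 3 (Fin.cons n z))
    hP hsupp hlim
  exact ⟨ρ, hPρ, hsuppρ, fun n z => (hmomρ n z).symm⟩

/-- **The joint spectral measure, with no mass at `λ ≤ 0` (registered stub
`jointSpectralMeasure_noAtom`).** There is a probability measure `ρ` on `ℝ³` carried by
`[0,1] × [-π,π]²`, giving no mass to `{λ ≤ 0}`, with `⟨σ₀σ_{(n,z)}⟩⁺_{β_c} = ∫ λ^{|n|} cos(k·z) dρ`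
for all `(n,z) ∈ ℤ × ℤ²`; the absence of the atom holds for EVERY representing measure
(`js_noAtom`, `js_momentDeterminacy`: positive-definite transfer matrix). This is the input of the
line's physical stub `rpInterpolatedGSM` (the RP interpolation `t ↦ ∫ λ^t cos(k·z) dρ` is then
continuous at `t = 0⁺`). -/
theorem jointSpectralMeasure_noAtom :
    ∃ ρ : Measure (Fin 3 → ℝ), IsProbabilityMeasure ρ ∧
      ρ {p | 0 ≤ p 0 ∧ p 0 ≤ 1 ∧ ∀ j : Fin 2, -Real.pi ≤ p j.succ ∧ p j.succ ≤ Real.pi}ᶜ = 0 ∧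
      ρ {p | p 0 ≤ 0} = 0 ∧
      ∀ (n : ℤ) (z : Fin 2 → ℤ), criticalTwoPoint 3 (Fin.cons n z) =
        ∫ p, (p 0) ^ n.natAbs * Real.cos (∑ j : Fin 2, p j.succ * (z j : ℝ)) ∂ρ := by
  obtain ⟨ρ, hP, hsupp, hrep⟩ := jointSpectralMeasure
  exact ⟨ρ, hP, hsupp, js_noAtom js_momentDeterminacy ρ hP hsupp hrep, hrep⟩

end

end Summit.CriticalPhenomena.Ising3DConformalLimit.Theorems
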